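import Mathlib
import Summits.CriticalPhenomena.CardyFormulaZ2.Theorems.CardySelfRefinementDefs
import Summits.CriticalPhenomena.CardyFormulaZ2.Theorems.CardySelfRefinementRussoDriftModel
import Summits.CriticalPhenomena.CardyFormulaZ2.Theorems.CardySelfRefinementRussoDriftPolynomial
import Summits.CriticalPhenomena.CardyFormulaZ2.Theorems.CardySelfRefinementTrivialSectorRateStubFourArmAboveOneSecondMomentReadout
import Summits.CriticalPhenomena.CardyFormulaZ2.Theorems.CardySelfRefinementTrivialSectorRateStubFourArmAboveOneCircuitBitsLocality
import Literature.Probability.Percolation.CrossingClusterCount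
import Literature.Probability.LatticeModels.ProdBernoulliReimer
import HarnessLib

/-!
# Helper (M2), part 2, of stub `stub_fourArmAboveOne`, line `far-field-is-a-quarter-turn`
(crux `TrivialSectorRate`, stmt-CriticalPhenomena-10266): tools for the coin-space BK tail bound
of the number of crossing clusters under `M_k`

Generic and geometric inputs of the tail bound `M_k(Z ≥ n) ≤ M_k(A)^n` (file
`…StubFourArmAboveOneSecondMomentTail.lean`):

* `mem_disjointOccurrencePow_of_certificates` — pairwise disjoint certificate sets `K i` with
  `[ω]_{K i} ⊆ A` put `ω` in the `n`-fold disjoint occurrence `A □ ⋯ □ A` (no monotonicity);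
* `prodBernoulli_real_disjointOccurrencePow_le` — iterated Reimer on an inhomogeneous coin product,
  `P(A □^n) ≤ P(A)^n` for local `A` (`prodBernoulli_reimer_local`);
* `exists_readout` (registered helper) — the second read-out of the self-refinement coins packaged
  (measurable, law `M_k(q)`, opens only lattice edges, explicit opening rule; from
  `coinLaw_map_readout_eq`, file `…StubFourArmAboveOneSecondMomentReadout.lean`);
* `determinedBy_preimage_readout` — events of the box `B(R)` pull back to LOCAL coin events;
* `exists_pos_of_ax`, `forall_dvd_iff_of_ax`, `pos_eq_zero_iff` — an axial edge is the `p`-th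
  sub-edge (`p < k`) of the bundle of its coarse base, and `p = 0` iff it is based at a coarse vertex.

References: D. Reimer, Combin. Probab. Comput. 9 (2000); G. Grimmett, *Percolation* (1999), §2.3;
J. van den Berg, P. Nolin, Progr. Probab. 77 (2020), §3.

Target file:
`Summits/CriticalPhenomena/CardyFormulaZ2/Theorems/CardySelfRefinementTrivialSectorRateStubFourArmAboveOneSecondMomentTools.lean`.
-/

noncomputable section

namespace Summit.CriticalPhenomena.CardyFormulaZ2.Theorems.CardySelfRefinement.FarField

open scoped Classical
open Set MeasureTheory ProbabilityTheory SimpleGraph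
open Literature.Probability.LatticeModels Literature.Probability.Percolation
open Literature.Probability.Percolation.QuadCrossing
open Summit.CriticalPhenomena.CardyFormulaZ2.Theses.CardySelfRefinement

/-! ### Disjoint certificates give iterated disjoint occurrence; iterated Reimer on the coin space -/

/-- **Pairwise disjoint certificates give iterated disjoint occurrence** (no monotonicity): if the
cylinders of `ω` over pairwise disjoint coordinate sets `K i`, `i < n`, all lie in `A`, then
`ω ∈ A □ ⋯ □ A` (`n` times). -/
theorem mem_disjointOccurrencePow_of_certificates {ι : Type*} {A : Set (Set ι)} :
    ∀ {n : ℕ} {ω : Set ι} (K : Fin n → Set ι), (∀ i, localCylinder (K i) ω ⊆ A) →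
      Pairwise (fun i j => Disjoint (K i) (K j)) → ω ∈ disjointOccurrencePow A n
  | 0, _, _, _, _ => Set.mem_univ _
  | n + 1, ω, K, hKA, hdisj => by
    rw [disjointOccurrencePow_succ]
    set L : Set ι := ⋃ i : Fin n, K i.succ with hL
    refine ⟨K 0, L, ?_, hKA 0, fun ω' hω' => ?_⟩
    · rw [hL, Set.disjoint_iUnion_right]
      exact fun i => hdisj (Fin.succ_ne_zero i).symm
    · refine mem_disjointOccurrencePow_of_certificates (fun i => K i.succ) (fun i ω'' hω'' => ?_)
        fun i j hij => hdisj fun h => hij (Fin.succ_injective _ h)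
      refine hKA i.succ fun c hc => ?_
      rw [hω'' c hc]
      exact hω' c (Set.mem_iUnion.2 ⟨i, hc⟩)

/-- **Iterated Reimer inequality on the coin space**: for a local event `A` of an inhomogeneous
product Bernoulli law, `P(A □^n) ≤ P(A)^n` (`prodBernoulli_reimer_local`, iterated; `A □^n` is
local again). -/
theorem prodBernoulli_real_disjointOccurrencePow_le {ι : Type*} (p : ι → unitInterval)
    {A : Set (Set ι)} (hAl : IsLocalEvent A) :
    ∀ n : ℕ, (prodBernoulli p).real (disjointOccurrencePow A n) ≤ ((prodBernoulli p).real A) ^ n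
  | 0 => by simp
  | n + 1 => by
    rw [disjointOccurrencePow_succ, pow_succ']
    calc (prodBernoulli p).real (A □ disjointOccurrencePow A n)
        ≤ (prodBernoulli p).real A * (prodBernoulli p).real (disjointOccurrencePow A n) :=
          prodBernoulli_reimer_local p hAl (hAl.disjointOccurrencePow n)
      _ ≤ (prodBernoulli p).real A * ((prodBernoulli p).real A) ^ n :=
          mul_le_mul_of_nonneg_left (prodBernoulli_real_disjointOccurrencePow_le p hAl n)
            measureReal_nonneg

/-! ### The second read-out, packaged -/

/-- **The second read-out of the self-refinement coins, packaged** (from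
`coinLaw_map_readout_eq`, `measurable_readout`, `edgeOf_mem_readout_iff`): a measurable map
`rd : coins → bond configurations` with law `M_k(q)` under the coin product, opening only lattice
edges `edgeOf (v, d)`, by the rule: an axial edge is open iff (selector on and shared on) or
(selector off and: shared on if the edge is the first sub-edge of its bundle, own coin on
otherwise); a non-axial edge iff its own coin is on. -/
theorem exists_readout {k : ℕ} (hk : 0 < k) (q : ℝ × ℝ) :
    ∃ rd : Set Coin → Set (Sym2 (Site 2)), Measurable rd ∧ (coinLaw k q).map rd = M k q.1 q.2 ∧
      (∀ (S : Set Coin) (e : Sym2 (Site 2)), e ∈ rd S → ∃ vd : Site 2 × Fin 2, e = edgeOf vd) ∧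
      ∀ (S : Set Coin) (v : Site 2) (d : Fin 2), edgeOf (v, d) ∈ rd S ↔ (if ax k (v, d) then
          ((tb k (v, d), d, (2 : Fin 3)) ∈ S ∧ (tb k (v, d), d, (1 : Fin 3)) ∈ S) ∨
            ((tb k (v, d), d, (2 : Fin 3)) ∉ S ∧
              (((∀ i, (k : ℤ) ∣ v i) ∧ (tb k (v, d), d, (1 : Fin 3)) ∈ S) ∨
                ((¬ ∀ i, (k : ℤ) ∣ v i) ∧ (v, d, (0 : Fin 3)) ∈ S)))
        else (v, d, (0 : Fin 3)) ∈ S) := by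
  refine ⟨fun S : Set Coin => cfg k {c : Coin | ((fun (σ : Set Coin) (c : Coin) =>
      if c.2.2 = 1 then (if (c.1, c.2.1, (2 : Fin 3)) ∈ σ then c else (ctr k c.1, c.2.1, (0 : Fin 3)))
      else if c.2.2 = 0 then
        (if (∀ i, (k : ℤ) ∣ c.1 i) ∧ (tb k (c.1, c.2.1), c.2.1, (2 : Fin 3)) ∉ σ
          then (tb k (c.1, c.2.1), c.2.1, (1 : Fin 3)) else c)
      else c) S c) ∈ S}, measurable_readout k,
    coinLaw_map_readout_eq hk q, fun S e he => ?_, fun S v d => edgeOf_mem_readout_iff hk S v d⟩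
  obtain ⟨v, d, rfl, -⟩ := he
  exact ⟨(v, d), rfl⟩

/-! ### Locality of the second read-out -/

/-- **Events of the box pull back to local coin events under the second read-out**: an event
determined by the pairs of `B(R)` pulls back to an event determined by the (finitely many) own
coins of the edges based in `B(R)` and shared coins / selectors of their coarse bases. -/
theorem determinedBy_preimage_readout {k : ℕ} {rd : Set Coin → Set (Sym2 (Site 2))}
    (hrd : ∀ (S : Set Coin) (v : Site 2) (d : Fin 2), edgeOf (v, d) ∈ rd S ↔ (if ax k (v, d) then
          ((tb k (v, d), d, (2 : Fin 3)) ∈ S ∧ (tb k (v, d), d, (1 : Fin 3)) ∈ S) ∨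
            ((tb k (v, d), d, (2 : Fin 3)) ∉ S ∧
              (((∀ i, (k : ℤ) ∣ v i) ∧ (tb k (v, d), d, (1 : Fin 3)) ∈ S) ∨
                ((¬ ∀ i, (k : ℤ) ∣ v i) ∧ (v, d, (0 : Fin 3)) ∈ S)))
        else (v, d, (0 : Fin 3)) ∈ S))
    (hrde : ∀ (S : Set Coin) (e : Sym2 (Site 2)), e ∈ rd S → ∃ vd : Site 2 × Fin 2, e = edgeOf vd)
    {B : Set (BondConfig (Site 2))} {R : ℕ} (hB : DeterminedBy B ↑(boxEdges R)) :
    DeterminedBy (rd ⁻¹' B)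
      ↑(((box 2 R) ×ˢ (Finset.univ : Finset (Fin 2))).biUnion fun vd : Site 2 × Fin 2 =>
        ({(vd.1, vd.2, (0 : Fin 3)), (tb k vd, vd.2, (1 : Fin 3)), (tb k vd, vd.2, (2 : Fin 3))} : Finset Coin)) := by
  rw [determinedBy_iff]
  intro S S' hSS'
  have hagree : ∀ (v : Site 2) (d : Fin 2), v ∈ box 2 R → ∀ c ∈ ({(v, d, (0 : Fin 3)), (tb k (v, d), d, (1 : Fin 3)),
      (tb k (v, d), d, (2 : Fin 3))} : Finset Coin), (c ∈ S ↔ c ∈ S') := by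
    intro v d hv c hc
    have hcF : c ∈ (↑(((box 2 R) ×ˢ (Finset.univ : Finset (Fin 2))).biUnion fun vd : Site 2 × Fin 2 =>
        ({(vd.1, vd.2, (0 : Fin 3)), (tb k vd, vd.2, (1 : Fin 3)), (tb k vd, vd.2, (2 : Fin 3))} : Finset Coin)) :
          Set Coin) := by
      rw [Finset.mem_coe, Finset.mem_biUnion]
      exact ⟨(v, d), Finset.mem_product.2 ⟨hv, Finset.mem_univ _⟩, hc⟩
    exact ⟨fun h => ((Set.ext_iff.1 hSS' c).1 ⟨h, hcF⟩).1, fun h => ((Set.ext_iff.1 hSS' c).2 ⟨h, hcF⟩).1⟩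
  -- the two read-outs agree on the pairs of the box
  have key : ∀ (S₁ S₂ : Set Coin), (∀ (v : Site 2) (d : Fin 2), v ∈ box 2 R →
      ∀ c ∈ ({(v, d, (0 : Fin 3)), (tb k (v, d), d, (1 : Fin 3)), (tb k (v, d), d, (2 : Fin 3))} : Finset Coin),
        (c ∈ S₁ ↔ c ∈ S₂)) → ∀ e ∈ (↑(boxEdges R) : Set (Sym2 (Site 2))), e ∈ rd S₁ → e ∈ rd S₂ := by
    intro S₁ S₂ h e heB he
    obtain ⟨⟨v, d⟩, rfl⟩ := hrde S₁ e he
    have hv : v ∈ box 2 R := by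
      rw [Finset.mem_coe] at heB
      exact (mk_mem_boxEdges.1 heB).1
    have h0 := h v d hv (v, d, 0) (by simp)
    have h1 := h v d hv (tb k (v, d), d, 1) (by simp)
    have h2 := h v d hv (tb k (v, d), d, 2) (by simp)
    rw [hrd] at he ⊢
    rw [← h0, ← h1, ← h2]
    exact he
  simp only [Set.mem_preimage]
  refine (determinedBy_iff _ _).1 hB (rd S) (rd S') (Set.ext fun e => ⟨fun he => ?_, fun he => ?_⟩)
  · exact ⟨key S S' hagree e he.2 he.1, he.2⟩
  · exact ⟨key S' S (fun v d hv c hc => (hagree v d hv c hc).symm) e he.2 he.1, he.2⟩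

/-! ### Geometry of the sub-edges of a bundle -/

/-- An axial edge with coarse base `u = tb k (v, d)` is the `p`-th sub-edge of its bundle for some
`p < k`: `v = ctr k u + p • e_d`. -/
theorem exists_pos_of_ax {k : ℕ} (hk : 0 < k) {v : Site 2} {d : Fin 2} (hax : ax k (v, d)) :
    ∃ p : ℕ, p < k ∧ ∀ i, v i = (k : ℤ) * tb k (v, d) i + (p : ℤ) * dirVec d i := by
  have hk0 : (0 : ℤ) < k := by exact_mod_cast hk
  refine ⟨(v d % (k : ℤ)).toNat, ?_, fun i => ?_⟩
  · have h1 := Int.emod_nonneg (v d) hk0.ne'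
    have h2 := Int.emod_lt_of_pos (v d) hk0
    omega
  · have hnn := Int.emod_nonneg (v d) hk0.ne'
    rw [Int.toNat_of_nonneg hnn]
    by_cases hid : i = d
    · subst hid
      rw [dirVec_apply_self, mul_one]
      exact (Int.mul_ediv_add_emod (v i) k).symm
    · rw [dirVec_apply_of_ne hid, mul_zero, add_zero]
      exact (Int.mul_ediv_cancel' (dvd_apply_of_ax hax hid)).symm

/-- For an axial edge, "based at a coarse vertex" is decided by the coordinate along the edge. -/
theorem forall_dvd_iff_of_ax {k : ℕ} {v : Site 2} {d : Fin 2} (hax : ax k (v, d)) :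
    (∀ i, (k : ℤ) ∣ v i) ↔ (k : ℤ) ∣ v d :=
  ⟨fun h => h d, fun h i => by
    by_cases hid : i = d
    · subst hid; exact h
    · exact dvd_apply_of_ax hax hid⟩

/-- The position of a sub-edge based at a coarse vertex is `0`. -/
theorem pos_eq_zero_iff {k : ℕ} {v : Site 2} {d : Fin 2} {p : ℕ} (hp : p < k)
    (hv : ∀ i, v i = (k : ℤ) * tb k (v, d) i + (p : ℤ) * dirVec d i) :
    (k : ℤ) ∣ v d ↔ p = 0 := by
  have hvd := hv d
  rw [dirVec_apply_self, mul_one] at hvd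
  constructor
  · intro h
    have h' : (k : ℤ) ∣ (p : ℤ) := by
      have : (p : ℤ) = v d - (k : ℤ) * tb k (v, d) d := by linarith
      rw [this]
      exact dvd_sub h (dvd_mul_right _ _)
    have hpk : (p : ℤ) < k := by exact_mod_cast hp
    have hp0 : (0 : ℤ) ≤ p := by positivity
    have := Int.eq_zero_of_dvd_of_nonneg_of_lt hp0 hpk h'
    exact_mod_cast this
  · rintro rfl
    rw [hvd]
    simp

end Summit.CriticalPhenomena.CardyFormulaZ2.Theorems.CardySelfRefinement.FarField

end
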